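import Summits.Ventures.PercRepro.ProfilePointedCircuitClassesInOutTenC

/-!
# PercRepro — THE IN–OUT INEQUALITY AT `n = 10`, IV: THE DOUBLE COUNTING AND THE THEOREM (p5, gen 40;
`proofs/P5-GM1.md` §59)

With the demands `𝒟` (bi-independent `4`-sets `W ∋ e`), the units `𝒰` (bi-independent `5`-sets `W' ∌ e`), the
neighbour relation `W ∩ W' = ∅`, the deficient demands `𝒯 := {W ∈ 𝒟 : W has ≤ 3 neighbours}` and the resource
relation `ℛ` of part III: `4·#𝒟 ≤ Σ_W s(W) + #𝒯` (every demand has `≥ 4` neighbours unless deficient, `≥ 3` always,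
part I), `Σ_{W'} p(W') + 2·#𝒰_ℛ ≤ 4·#𝒰` (`p ≤ 4`, and `p ≤ 2` on the units `𝒰_ℛ` that are resources, part III),
`3·#𝒯 ≤ Σ_{W ∈ 𝒯} #{W' : W ℛ W'} = Σ_{W'} #{W ∈ 𝒯 : W ℛ W'} ≤ 5·#𝒰_ℛ` (parts II–III), and the two counts of the
neighbour pairs agree: `4·#𝒟 ≤ Σ s + #𝒯 = Σ p + #𝒯 ≤ Σ p + 2·#𝒰_ℛ ≤ 4·#𝒰`.

* **`inCount_four_le_outCount_five_of_ten`**: `in_4(e) ≤ out_5(e)` on `#E = 10`, `ρ(E) = 6`, at every point `e` that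
  is not a coloop and such that `E − e` has no coloops.
-/

open scoped Matroid

namespace PercRepro.Cogirth

open Finset ThmH Skew Shadow Profile

variable {α : Type} [DecidableEq α] {N : Matroid α} [N.Finite] {e : α}

section InOutTenD

/-- **THE IN–OUT INEQUALITY AT `n = 10`**: on a matroid with `#E = 10`, `ρ(E) = 6`, at every point `e` that is not
a coloop and such that `E − e` has no coloops, `in_4(e) ≤ out_5(e)`. -/
theorem inCount_four_le_outCount_five_of_ten (hn : (gr N).card = 10) (hR : rk N (gr N) = 6) (he : e ∈ gr N)
    (hnc : rk N ((gr N).erase e) = 6)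
    (hcf' : ∀ x ∈ (gr N).erase e, rk N (((gr N).erase e).erase x) = 6) :
    inCount N 4 e ≤ outCount N 5 e := by
  -- `N` has no coloops
  have hcf : ∀ x ∈ gr N, rk N ((gr N).erase x) = 6 := by
    intro x hx
    by_cases hxe : x = e
    · rw [hxe]; exact hnc
    · have h1 := hcf' x (mem_erase.2 ⟨hxe, hx⟩)
      have h2 := rk_mono' (M := N) (show ((gr N).erase e).erase x ⊆ (gr N).erase x by
        rw [erase_right_comm]; exact erase_subset _ _)
      have h3 := rk_mono' (M := N) (erase_subset x (gr N))
      omega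
  unfold inCount outCount
  set D := (biIndepSets N 4).filter (fun W => e ∈ W) with hDdef
  set U := (biIndepSets N 5).filter (fun W' => e ∉ W') with hUdef
  set T := D.filter (fun W => (U.filter (fun W' => W ∩ W' = ∅)).card ≤ 3) with hTdef
  -- (i) the neighbour pairs, counted from both sides
  have hdc : ∑ W ∈ D, (U.filter (fun W' => W ∩ W' = ∅)).card =
      ∑ W' ∈ U, (D.filter (fun W => W ∩ W' = ∅)).card := by
    have h := sum_card_bipartiteAbove_eq_sum_card_bipartiteBelow
      (r := fun (W W' : Finset α) => W ∩ W' = ∅) (s := D) (t := U)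
    simp only [bipartiteAbove, bipartiteBelow] at h
    exact h
  -- (ii) every demand has `≥ 4` neighbours unless deficient, and `≥ 3` always
  have hlow : ∀ W ∈ D, 4 ≤ (U.filter (fun W' => W ∩ W' = ∅)).card + (if W ∈ T then 1 else 0) := by
    intro W hW
    have hW4 : W ∈ biIndepSets N 4 := (mem_filter.1 hW).1
    have heW : e ∈ W := (mem_filter.1 hW).2
    have hWg : W ⊆ gr N := (mem_biIndepSets.1 hW4).1
    have hWcard : W.card = 4 := (mem_biIndepSets.1 hW4).2.1
    have hWrk : rk N W = 4 := by rw [(mem_biIndepSets.1 hW4).2.2.1, hWcard]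
    have h1 := card_filter_rk_insert_eq_five_le_card_disjoint_units hn hW4 heW
    rw [← hUdef] at h1
    have h2 := card_filter_rk_insert_eq_four_le_three hn hcf hW4
    have hBcard : (gr N \ W).card = 6 := by rw [card_sdiff_of_subset hWg, hn, hWcard]
    have hsplit := card_filter_add_card_filter_not (s := gr N \ W) (p := fun z => rk N (insert z W) = 5)
    have hKeq : (gr N \ W).filter (fun z => ¬ rk N (insert z W) = 5) =
        (gr N \ W).filter (fun z => rk N (insert z W) = 4) := by
      apply filter_congr
      intro z hz
      have h3 := rk_insert_le_add_one (mem_sdiff.1 hz).1 hWg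
      have h4 := rk_mono' (M := N) (subset_insert z W)
      omega
    rw [hKeq, hBcard] at hsplit
    split_ifs with hT
    · omega
    · have h5 : ¬ (U.filter (fun W' => W ∩ W' = ∅)).card ≤ 3 := fun h => hT (mem_filter.2 ⟨hW, h⟩)
      omega
  have hsumlow : 4 * D.card ≤ ∑ W ∈ D, (U.filter (fun W' => W ∩ W' = ∅)).card + T.card := by
    have h := card_nsmul_le_sum D (fun W => (U.filter (fun W' => W ∩ W' = ∅)).card + (if W ∈ T then 1 else 0))
      4 hlow
    rw [smul_eq_mul, sum_add_distrib, ← card_filter, Nat.mul_comm] at h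
    have hTD : D.filter (fun W => W ∈ T) = T := by
      ext W
      rw [mem_filter]
      exact ⟨fun h => h.2, fun h => ⟨(mem_filter.1 h).1, h⟩⟩
    rw [hTD] at h
    exact h
  -- (iii) the units paid by the deficient demands
  have hup : ∀ W' ∈ U, (D.filter (fun W => W ∩ W' = ∅)).card +
      2 * (if ∃ W ∈ T, (W ∩ W').card = 1 ∧ ((gr N \ W') \ W).card = 2 ∧
        rk N (gr N \ ((gr N \ W') \ W)) = 5 then 1 else 0) ≤ 4 := by
    intro W' hW'
    split_ifs with hex
    · obtain ⟨W, hWT, hc1, hc2, hr⟩ := hex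
      have hWg : W ⊆ gr N := (mem_biIndepSets.1 (mem_filter.1 (mem_filter.1 hWT).1).1).1
      have := card_filter_disjoint_demands_le_two hn hW' (π := (gr N \ W') \ W) sdiff_subset hc2 hr
      rw [← hDdef] at this
      omega
    · have := card_filter_disjoint_demands_le_four hn he hW'
      rw [← hDdef] at this
      omega
  have hsumup : ∑ W' ∈ U, (D.filter (fun W => W ∩ W' = ∅)).card +
      2 * (U.filter (fun W' => ∃ W ∈ T, (W ∩ W').card = 1 ∧ ((gr N \ W') \ W).card = 2 ∧
        rk N (gr N \ ((gr N \ W') \ W)) = 5)).card ≤ 4 * U.card := by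
    have h := sum_le_card_nsmul U (fun W' => (D.filter (fun W => W ∩ W' = ∅)).card +
      2 * (if ∃ W ∈ T, (W ∩ W').card = 1 ∧ ((gr N \ W') \ W).card = 2 ∧
        rk N (gr N \ ((gr N \ W') \ W)) = 5 then 1 else 0)) 4 hup
    rw [smul_eq_mul, sum_add_distrib, ← mul_sum, ← card_filter] at h
    linarith
  -- (iv) the resource relation: `3·#T ≤ 5·#U_ℛ`
  have hres : 3 * T.card ≤ 5 * (U.filter (fun W' => ∃ W ∈ T, (W ∩ W').card = 1 ∧
      ((gr N \ W') \ W).card = 2 ∧ rk N (gr N \ ((gr N \ W') \ W)) = 5)).card := by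
    have hdc' : ∑ W ∈ T, (U.filter (fun W' => (W ∩ W').card = 1 ∧ ((gr N \ W') \ W).card = 2 ∧
        rk N (gr N \ ((gr N \ W') \ W)) = 5)).card =
        ∑ W' ∈ U, (T.filter (fun W => (W ∩ W').card = 1 ∧ ((gr N \ W') \ W).card = 2 ∧
        rk N (gr N \ ((gr N \ W') \ W)) = 5)).card := by
      have h := sum_card_bipartiteAbove_eq_sum_card_bipartiteBelow
        (r := fun (W W' : Finset α) => (W ∩ W').card = 1 ∧ ((gr N \ W') \ W).card = 2 ∧
          rk N (gr N \ ((gr N \ W') \ W)) = 5) (s := T) (t := U)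
      simp only [bipartiteAbove, bipartiteBelow] at h
      exact h
    have hlow' : ∀ W ∈ T, 3 ≤ (U.filter (fun W' => (W ∩ W').card = 1 ∧ ((gr N \ W') \ W).card = 2 ∧
        rk N (gr N \ ((gr N \ W') \ W)) = 5)).card := by
      intro W hW
      rw [hTdef, mem_filter] at hW
      exact three_le_card_filter_resource hn hcf hcf' hW.1 hW.2
    have hup' : ∀ W' ∈ U, (T.filter (fun W => (W ∩ W').card = 1 ∧ ((gr N \ W') \ W).card = 2 ∧
        rk N (gr N \ ((gr N \ W') \ W)) = 5)).card ≤
        5 * (if ∃ W ∈ T, (W ∩ W').card = 1 ∧ ((gr N \ W') \ W).card = 2 ∧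
          rk N (gr N \ ((gr N \ W') \ W)) = 5 then 1 else 0) := by
      intro W' hW'
      split_ifs with hex
      · have h1 := card_filter_resource_le_five hR hcf hW'
        rw [← hDdef] at h1
        have h2 : (T.filter (fun W => (W ∩ W').card = 1 ∧ ((gr N \ W') \ W).card = 2 ∧
            rk N (gr N \ ((gr N \ W') \ W)) = 5)).card ≤
            (D.filter (fun W => (W ∩ W').card = 1 ∧ ((gr N \ W') \ W).card = 2 ∧
            rk N (gr N \ ((gr N \ W') \ W)) = 5)).card :=
          card_le_card (filter_subset_filter _ (filter_subset _ _))
        omega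
      · rw [mul_zero, Nat.le_zero, card_eq_zero, filter_eq_empty_iff]
        intro W hW hrel
        exact hex ⟨W, hW, hrel⟩
    have h1 := card_nsmul_le_sum T (fun W => (U.filter (fun W' => (W ∩ W').card = 1 ∧
      ((gr N \ W') \ W).card = 2 ∧ rk N (gr N \ ((gr N \ W') \ W)) = 5)).card) 3 hlow'
    have h2 := sum_le_sum hup'
    rw [← mul_sum, ← card_filter] at h2
    rw [smul_eq_mul] at h1
    omega
  -- (v) conclusion
  have hfinal : 4 * D.card ≤ 4 * U.card := by
    calc 4 * D.card ≤ ∑ W ∈ D, (U.filter (fun W' => W ∩ W' = ∅)).card + T.card := hsumlow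
      _ = ∑ W' ∈ U, (D.filter (fun W => W ∩ W' = ∅)).card + T.card := by rw [hdc]
      _ ≤ 4 * U.card := by omega
  omega

end InOutTenD

end PercRepro.Cogirth
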